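import Summits.AnomalousDissipation.AnomalousDissipation.Theorems.SawtoothPulseCascadeK1LocalisedCascadeHalfStepHCT
import Summits.AnomalousDissipation.AnomalousDissipation.Theorems.SawtoothPulseCascadeK1LocalisedCascadeWindowBlockHO

/-!
# K1loc, line `Spectral` — helper: THE WINDOW BLOCK LEMMA (H-step), CORNER-TRACE GRADE (S-D, arbiter A23-13 (2))

The CT twin of `…WindowBlockHO.sum_windowBlock_hstep_osc_le`: the H half-step `…HalfStepHCT.sum_window_sq_norm_hstep_ct_le`
on a window block `Λ ≤ |k₀| ≤ Λ'`, `|k₁| + Q₂ ≤ p(k₀)`, with gap `p(k₀) + D_m ≤ |k₀|G`, a source multiplier `χ` supported in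
`[−Q₂, Q₂]`, real-valued in `[0,1]` and `= 1` on `|l| ≤ Q₁` (any trapezoid — e.g. the box-product trapezoids of
`…TraceKernels`), and the pass-through term converted to the spectral class `{Λ ≤ |k₀| ≤ Λ', Q₁ < |k₁|}` of the INPUT by
`…StripBlockH.sum_passThrough_le_tsum_h`.  The corner-trace bound `Θ`, the tracked energy `E` and the residue count `M_c` stay
hypotheses (discharged by `…TraceInput` / `…TraceKernels` / `…TraceEnergy`).
-/

-- `Summit.<Summit>.<Problem>`: single-conjunct summit, the duplicate namespace segment is deliberate.
set_option linter.dupNamespace false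

namespace Summit.AnomalousDissipation.AnomalousDissipation.Theorems.SawtoothPulseCascade.K1Window

open MeasureTheory Set Filter Topology UnitAddTorus Function Complex Metric
open scoped Real ENNReal
open Literature.Analysis Literature.Analysis.FunctionSpaces Literature.Analysis.FunctionSpaces.Torus Literature.Analysis.FluidPDE
open Literature.Analysis.FluidPDE.ShearStage
open Literature.Analysis.FluidPDE.SawtoothCascade Literature.Analysis.FluidPDE.SawtoothCascade.CascadeParams
open Summit.AnomalousDissipation.AnomalousDissipation.Theorems.SawtoothPulseCascade.K1Start

/-- **THE WINDOW BLOCK LEMMA, H-STEP, CORNER-TRACE GRADE.**  For the H half-step `a = b ∘ Φ_H` of the cascade (integer strain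
`γ = G`), a window block `W` with `Λ ≤ |k₀| ≤ Λ'`, `|k₁| + Q₂ ≤ p(k₀)`, `p(k₀) + D_m ≤ |k₀|G` (`D_m ≥ 1`), a multiplier `χ`
(support `⊂ [−Q₂,Q₂]`, values in `[0,1]`, `= 1` on `|l| ≤ Q₁`), residue-count bound `M_c`, corner-trace bound `Θ`, tracked
energy bound `E`, zone parameter `M ≥ 1` with `Mδ_j < π/2`, and `η ≥ 2π Λ'G e^{−M²/2}/(2N_j)`:
`Σ_{k∈W}|𝓕a(k)|² ≤ (√(3N_jσ/π²·4N_jΘ + 12N_j²Q₂²M_cσ/(π²D_m²)·E) + √(η²E + 8Mδ_jΘ/π) + √(Σ'_{Λ≤|k₀|≤Λ', Q₁<|k₁|}|𝓕b(k)|²))²`,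
`σ = 1/(D_m+Q₂)² + 1/(N_j(D_m+Q₂))`. [cite: Grafakos2014, Prop. 3.1.2 (5), Prop. 3.2.7 (3)] -/
theorem sum_windowBlock_hstep_ct_le (P : CascadeParams) {G : ℕ} (hγ : P.γ = G) (hδ₀ : 0 < P.δ₀) (hd : 0 < P.d)
    (hN₀ : 1 ≤ P.N₀) (hρN : 1 ≤ P.ρN) (j : ℕ)
    {b : UnitAddTorus (Fin 2) → ℂ} (hb : Continuous b) (hbs : Summable fun k => ‖mFourierCoeff b k‖)
    {Q₁ Q₂ Λ Λ' Dm : ℕ} (χ : ℤ → ℂ) (hχS : ∀ l, l ∉ Finset.Icc (-(Q₂ : ℤ)) Q₂ → χ l = 0)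
    (hχr : ∀ l, ∃ r : ℝ, 0 ≤ r ∧ r ≤ 1 ∧ χ l = (r : ℂ)) (hχ1 : ∀ l : ℤ, |l| ≤ Q₁ → χ l = 1) (p : ℤ → ℕ)
    (W : Finset (Fin 2 → ℤ)) (hW : ∀ k ∈ W, (Λ : ℤ) ≤ |k 0| ∧ |k 0| ≤ Λ')
    (hWp : ∀ k ∈ W, |k 1| + Q₂ ≤ (p (k 0) : ℤ)) (hDm : 0 < Dm) (hD : ∀ k ∈ W, (p (k 0) : ℤ) + Dm ≤ |k 0| * G)
    {Mc : ℝ} (hMc : ∀ k : ℤ, ((((Finset.Icc (-(Q₂ : ℤ)) Q₂).filter fun l => (P.N j : ℤ) ∣ k - l).card : ℕ) : ℝ) ≤ Mc)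
    {Θ E M η : ℝ} (hΘ : ∀ y : ℝ, ∑ n ∈ W.image (fun k => k 0),
      ‖∑ l ∈ Finset.Icc (-(Q₂ : ℤ)) Q₂, χ l * mFourierCoeff b ![n, l] * cexp (2 * π * I * l * y)‖ ^ 2 ≤ Θ)
    (hE : ∑ n ∈ W.image (fun k => k 0), ∑ l ∈ Finset.Icc (-(Q₂ : ℤ)) Q₂, ‖χ l * mFourierCoeff b ![n, l]‖ ^ 2 ≤ E)
    (hM : 1 ≤ M) (hMδ : M * P.δ j < π / 2)
    (hη : 2 * π * ((Λ' * G : ℕ) : ℝ) * (Real.exp (-(M ^ 2 / 2)) / (2 * P.N j)) ≤ η) :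
    ∑ k ∈ W, ‖mFourierCoeff (b ∘ shearMap 0 1 (amp ⟨P.U j, P.U_periodic j, P.contDiff_U (P.δ_pos hδ₀ hd j)⟩ P.γ)) k‖ ^ 2 ≤
      (Real.sqrt (3 * P.N j * (1 / ((Dm : ℝ) + Q₂) ^ 2 + 1 / (P.N j * ((Dm : ℝ) + Q₂))) / π ^ 2 * (4 * P.N j * Θ) +
            12 * (P.N j : ℝ) ^ 2 * (Q₂ : ℝ) ^ 2 * Mc * (1 / ((Dm : ℝ) + Q₂) ^ 2 + 1 / (P.N j * ((Dm : ℝ) + Q₂))) /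
              (π ^ 2 * (Dm : ℝ) ^ 2) * E) +
          Real.sqrt (η ^ 2 * E + 8 * M * P.δ j / π * Θ) +
        Real.sqrt (∑' k : Fin 2 → ℤ, (if (Λ : ℤ) ≤ |k 0| ∧ |k 0| ≤ Λ' ∧ (Q₁ : ℤ) < |k 1| then (1 : ℝ) else 0) *
          ‖mFourierCoeff b k‖ ^ 2)) ^ 2 := by
  classical
  have hNpos : 0 < P.N j := N_pos P hN₀ hρN j
  have hNr : (0 : ℝ) < P.N j := by exact_mod_cast hNpos
  have hχn : ∀ l, ‖χ l‖ ≤ 1 := fun l => by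
    obtain ⟨r, hr0, hr1, hr⟩ := hχr l
    rw [hr, Complex.norm_real, Real.norm_of_nonneg hr0]; exact hr1
  have hSL : ∀ l ∈ Finset.Icc (-(Q₂ : ℤ)) Q₂, |l| ≤ (Q₂ : ℤ) := fun l hl => abs_le.mpr (Finset.mem_Icc.mp hl)
  have hWD : ∀ k ∈ W, |k 1| + (Q₂ : ℤ) + Dm ≤ |k 0| * G := fun k hk => by linarith [hWp k hk, hD k hk]
  have hη' : ∀ k ∈ W, 2 * π * |((k 0 * G : ℤ) : ℝ)| * (Real.exp (-(M ^ 2 / 2)) / (2 * P.N j)) ≤ η := by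
    intro k hk
    refine le_trans (mul_le_mul_of_nonneg_right (mul_le_mul_of_nonneg_left ?_ (by positivity)) (by positivity)) hη
    rw [← Int.cast_abs, abs_mul, abs_of_nonneg (Int.natCast_nonneg G)]
    have h2 := (hW k hk).2
    have : |k 0| * (G : ℤ) ≤ (Λ' : ℤ) * G := mul_le_mul_of_nonneg_right h2 (Int.natCast_nonneg G)
    exact_mod_cast this
  have hmain := sum_window_sq_norm_hstep_ct_le P hγ hδ₀ hd hN₀ hρN j hb hbs W χ _ hχS hχn hSL hDm hWD hMc hΘ hE
    hM hMδ hη'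
  refine hmain.trans (pow_le_pow_left₀ (by positivity) (add_le_add le_rfl (Real.sqrt_le_sqrt ?_)) 2)
  exact sum_passThrough_le_tsum_h hb hχS hχr hχ1 _ fun n hn => by
    obtain ⟨k, hk, rfl⟩ := Finset.mem_image.mp hn
    exact hW k hk

end Summit.AnomalousDissipation.AnomalousDissipation.Theorems.SawtoothPulseCascade.K1Window
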